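import Summits.HubbardSuperconductivity.HubbardSuperconductivity.Theorems.ThermalWedgeTwSourcedInertnessZeroSourceResponse

/-!
# Crux `TwSourcedInertness` (stmt-HubbardSuperconductivity-1696) is EQUIVALENT to the linear
pair-amplitude response law

`--supports` file (prover seat 1), the converse of
`ThermalWedgeTwSourcedInertnessZeroSourceResponse.tw_sourcedPairAmplitude_of_inertness`.
There the crux (`p̃_L(β,μ,U,h) − p̃_L(β,μ,U,0) ≤ C(1 + log β)h²` for all real `h`, in the window
`0 < U ≤ U₀`, `1 ≤ β ≤ e^{a/U}`, `μ ∈ [μ₁,μ₂]`, eventually in `L`) was shown to force the LINEAR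
RESPONSE of the induced anomalous `d`-wave density, `0 ≤ Re⟨Δ_d + Δ_d†⟩_{β,H_{L,t}}/L² ≤ 4C(1 + log β)t`
for `t > 0`, `H_{L,t} = dWaveSourceTorus L U μ t = hubbardTorusWith 2 L 1 U μ − t(Δ_d + Δ_d†)`.
Here the converse is proved, so that the two statements are equivalent (same `U₀, a`, constants
`C ↦ 4C ↦ 4C`):

* `twConv_pressure_le_of_pairAmplitude_le` — on ONE torus, for `β > 0`: if
  `Re⟨Δ_d + Δ_d†⟩_{β,H_{L,t}}/L² ≤ K·t` for all `t > 0`, then `p̃_L(h) − p̃_L(0) ≤ K·h²` for ALL real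
  `h`.  For `h > 0` this is the Peierls–Bogoliubov tangent at the endpoint `H_{L,h}`
  (`twNec_gain_le_mul_re_gibbsState_source`: `log Z(H_{L,h}) − log Z(H_{L,0}) ≤ βh·Re⟨Q⟩_{H_{L,h}}`),
  for `h < 0` the gauge evenness `Z(H_{L,−h}) = Z(H_{L,h})` (`partitionFn_dWaveSourceTorus_neg`),
  and `h = 0` is trivial — no differentiability and no convexity argument is needed;
* `twSourcedInertness_of_sourcedPairAmplitude` — the quantified converse: the linear
  pair-amplitude response law (upper bound only) implies `TwSourcedInertness` with the SAME
  constants;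
* `twSourcedInertness_iff_sourcedPairAmplitude` — the crux is equivalent to the two-sided law
  `0 ≤ Re⟨Δ_d + Δ_d†⟩_{β,H_{L,t}}/L² ≤ C(1 + log β)·t` (`t > 0`, same window, eventually in `L`).

So the crux may be attacked as a bound on an ORDER PARAMETER (the sourced anomalous density is at
most linear in the source with slope `≲ 1 + log β`, at every source strength) rather than on the
pressure: this is the form in which Lee–Yang / Griffiths-type and monotonicity arguments operate.
No definition is introduced; nothing is assumed; standard axioms.

Sources: O. Bratteli, D. W. Robinson, *Operator Algebras and QSM II* (1997) §5.3 (Peierls–Bogoliubov)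
[BratteliRobinsonII1997]; T. Koma, H. Tasaki, PRL 68 (1992) 3248, eqs. (7)–(8) (gauge rotation)
[KomaTasakiPRL1992]; F. J. Dyson, E. H. Lieb, B. Simon, J. Stat. Phys. 18 (1978) 335, §3 [DLS1978].
Tree: `twNec_gain_le_mul_re_gibbsState_source`, `tw_sourcedPairAmplitude_of_inertness`
(`ThermalWedgeTwSourcedInertnessZeroSourceResponse`), `partitionFn_dWaveSourceTorus_neg`
(`TwSourcedCondensation.Negative.SourceResponseStructure`), `dWaveSourceTorus_zero`,
`isHermitian_hubbardTorusWith`, `isHermitian_pairField_add_conjTranspose`, `cast_sq_pos_of_neZero`.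
-/

set_option linter.dupNamespace false

noncomputable section

namespace Summit.HubbardSuperconductivity.HubbardSuperconductivity.Theorems

open Matrix Finset Literature.MathematicalPhysics.QuantumLattice
open Literature.Probability.LatticeModels
open Summit.HubbardSuperconductivity.HubbardSuperconductivity.Theses.ThermalWedge
open Summit.HubbardSuperconductivity.HubbardSuperconductivity.Theorems.TwSourcedCondensation.Negative
open scoped Matrix.Norms.L2Operator ComplexOrder

/-! ### One torus: linear amplitude response gives the quadratic pressure bound -/

section Torus

variable (L : ℕ) [NeZero L]

/-- **Positive sources.** For `β > 0`, if `Re⟨Δ_d + Δ_d†⟩_{β,H_{L,t}}/L² ≤ K·t` for all `t > 0`, then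
`p̃_L(t) − p̃_L(0) ≤ K·t²` for all `t > 0`: the Peierls–Bogoliubov tangent at `H_{L,t}` towards
`H_{L,0}`, `log Z(H_{L,t}) − log Z(H_{L,0}) ≤ βt·Re⟨Q⟩_{H_{L,t}}`. [cite: BratteliRobinsonII1997, §5.3] -/
theorem twConv_pressure_le_of_pairAmplitude_le_pos {β : ℝ} (hβ : 0 < β) (U μ : ℝ) {K : ℝ}
    (hA : ∀ t : ℝ, 0 < t →
      (gibbsState β (dWaveSourceTorus L U μ t)
          (pairField dWaveFormFactor L + (pairField dWaveFormFactor L)ᴴ)).re / (L : ℝ) ^ 2 ≤ K * t)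
    {t : ℝ} (ht : 0 < t) :
    Real.log (partitionFn β (dWaveSourceTorus L U μ t)).re / (β * (L : ℝ) ^ 2) -
        Real.log (partitionFn β (dWaveSourceTorus L U μ 0)).re / (β * (L : ℝ) ^ 2) ≤ K * t ^ 2 := by
  have hL : (0 : ℝ) < (L : ℝ) ^ 2 := cast_sq_pos_of_neZero L
  have hden : 0 < β * (L : ℝ) ^ 2 := mul_pos hβ hL
  have hHK := isHermitian_hubbardTorusWith L 1 U μ
  have hQ := isHermitian_pairField_add_conjTranspose L
  rw [← sub_div, div_le_iff₀ hden, dWaveSourceTorus_zero]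
  have hKt : dWaveSourceTorus L U μ t = hubbardTorusWith 2 L 1 U μ -
      (t : ℂ) • (pairField dWaveFormFactor L + (pairField dWaveFormFactor L)ᴴ) := rfl
  have hPB := twNec_gain_le_mul_re_gibbsState_source hHK hQ β t
  rw [← hKt] at hPB
  have hm := hA t ht
  rw [div_le_iff₀ hL] at hm
  have hβt : 0 ≤ β * t := (mul_pos hβ ht).le
  calc Real.log (partitionFn β (dWaveSourceTorus L U μ t)).re -
        Real.log (partitionFn β (hubbardTorusWith 2 L 1 U μ)).re
      ≤ β * (t * (gibbsState β (dWaveSourceTorus L U μ t)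
          (pairField dWaveFormFactor L + (pairField dWaveFormFactor L)ᴴ)).re) := hPB
    _ = (β * t) * (gibbsState β (dWaveSourceTorus L U μ t)
          (pairField dWaveFormFactor L + (pairField dWaveFormFactor L)ᴴ)).re := by ring
    _ ≤ (β * t) * (K * t * (L : ℝ) ^ 2) := mul_le_mul_of_nonneg_left hm hβt
    _ = K * t ^ 2 * (β * (L : ℝ) ^ 2) := by ring

/-- **All sources.** For `β > 0`, if `Re⟨Δ_d + Δ_d†⟩_{β,H_{L,t}}/L² ≤ K·t` for all `t > 0`, then
`p̃_L(h) − p̃_L(0) ≤ K·h²` for EVERY real `h` (negative sources by the gauge evenness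
`Z(H_{L,−h}) = Z(H_{L,h})`, `h = 0` trivially). [cite: KomaTasakiPRL1992, eqs. (7)–(8)] -/
theorem twConv_pressure_le_of_pairAmplitude_le {β : ℝ} (hβ : 0 < β) (U μ : ℝ) {K : ℝ}
    (hA : ∀ t : ℝ, 0 < t →
      (gibbsState β (dWaveSourceTorus L U μ t)
          (pairField dWaveFormFactor L + (pairField dWaveFormFactor L)ᴴ)).re / (L : ℝ) ^ 2 ≤ K * t)
    (h : ℝ) :
    Real.log (partitionFn β (dWaveSourceTorus L U μ h)).re / (β * (L : ℝ) ^ 2) -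
        Real.log (partitionFn β (dWaveSourceTorus L U μ 0)).re / (β * (L : ℝ) ^ 2) ≤ K * h ^ 2 := by
  rcases lt_trichotomy h 0 with hneg | hzero | hpos
  · have h' := twConv_pressure_le_of_pairAmplitude_le_pos L hβ U μ hA (neg_pos.mpr hneg)
    rw [partitionFn_dWaveSourceTorus_neg, neg_sq] at h'
    exact h'
  · subst hzero
    simp
  · exact twConv_pressure_le_of_pairAmplitude_le_pos L hβ U μ hA hpos

end Torus

/-! ### The quantified statements: the crux from, and as, the linear pair-amplitude response law -/

/-- **The linear pair-amplitude response law implies the crux, with the same constants.** If for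
every compact `[μ₁,μ₂] ⊂ (−4,0)` there are `U₀, a, C > 0` such that for `0 < U ≤ U₀`,
`1 ≤ β ≤ e^{a/U}`, `μ ∈ [μ₁,μ₂]`, eventually in `L`, and every `t > 0`,
`Re⟨Δ_d + Δ_d†⟩_{β,H_{L,t}}/L² ≤ C(1 + log β)·t`, then `TwSourcedInertness` holds (with these
`U₀, a, C`). [cite: BratteliRobinsonII1997, §5.3] -/
theorem twSourcedInertness_of_sourcedPairAmplitude
    (hA : ∀ μ₁ μ₂ : ℝ, -4 < μ₁ → μ₁ ≤ μ₂ → μ₂ < 0 → ∃ U₀ a C : ℝ, 0 < U₀ ∧ 0 < a ∧ 0 < C ∧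
      ∀ U : ℝ, 0 < U → U ≤ U₀ → ∀ β : ℝ, 1 ≤ β → β ≤ Real.exp (a / U) → ∀ μ ∈ Set.Icc μ₁ μ₂,
        ∃ L₀ : ℕ, ∀ (L : ℕ) [NeZero L], L₀ ≤ L → ∀ t : ℝ, 0 < t →
          (Matrix.gibbsState β
                (Literature.MathematicalPhysics.QuantumLattice.dWaveSourceTorus L U μ t)
                (Literature.MathematicalPhysics.QuantumLattice.pairField
                  Literature.MathematicalPhysics.QuantumLattice.dWaveFormFactor L +
                  (Literature.MathematicalPhysics.QuantumLattice.pairField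
                    Literature.MathematicalPhysics.QuantumLattice.dWaveFormFactor L)ᴴ)).re /
              (L : ℝ) ^ 2 ≤
            C * (1 + Real.log β) * t) :
    Summit.HubbardSuperconductivity.HubbardSuperconductivity.Theses.ThermalWedge.TwSourcedInertness := by
  intro μ₁ μ₂ h1 h12 h2
  obtain ⟨U₀, a, C, hU₀, ha, hC, hU⟩ := hA μ₁ μ₂ h1 h12 h2
  refine ⟨U₀, a, C, hU₀, ha, hC, fun U hU0 hUU₀ β hβ1 hβa μ hμ => ?_⟩
  obtain ⟨L₀, hL₀⟩ := hU U hU0 hUU₀ β hβ1 hβa μ hμ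
  refine ⟨L₀, fun L _ hL h => ?_⟩
  have hβ : 0 < β := lt_of_lt_of_le one_pos hβ1
  exact twConv_pressure_le_of_pairAmplitude_le L hβ U μ (K := C * (1 + Real.log β))
    (fun t ht => hL₀ L hL t ht) h

/-- **The crux `TwSourcedInertness` is equivalent to the linear pair-amplitude response law**: for
every compact `[μ₁,μ₂] ⊂ (−4,0)` there are `U₀, a, C > 0` such that for `0 < U ≤ U₀`,
`1 ≤ β ≤ e^{a/U}`, `μ ∈ [μ₁,μ₂]`, eventually in `L`, and every source `t > 0`, the induced anomalous
`d`-wave density of the sourced torus Gibbs state obeys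
`0 ≤ Re⟨Δ_d + Δ_d†⟩_{β,H_{L,t}}/L² ≤ C(1 + log β)·t` (forward with `C ↦ 4C`,
`tw_sourcedPairAmplitude_of_inertness`; backward with the same `C`). [cite: DLS1978, §3] -/
theorem twSourcedInertness_iff_sourcedPairAmplitude :
    Summit.HubbardSuperconductivity.HubbardSuperconductivity.Theses.ThermalWedge.TwSourcedInertness ↔
    ∀ μ₁ μ₂ : ℝ, -4 < μ₁ → μ₁ ≤ μ₂ → μ₂ < 0 → ∃ U₀ a C : ℝ, 0 < U₀ ∧ 0 < a ∧ 0 < C ∧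
      ∀ U : ℝ, 0 < U → U ≤ U₀ → ∀ β : ℝ, 1 ≤ β → β ≤ Real.exp (a / U) → ∀ μ ∈ Set.Icc μ₁ μ₂,
        ∃ L₀ : ℕ, ∀ (L : ℕ) [NeZero L], L₀ ≤ L → ∀ t : ℝ, 0 < t →
          0 ≤ (Matrix.gibbsState β
                (Literature.MathematicalPhysics.QuantumLattice.dWaveSourceTorus L U μ t)
                (Literature.MathematicalPhysics.QuantumLattice.pairField
                  Literature.MathematicalPhysics.QuantumLattice.dWaveFormFactor L +
                  (Literature.MathematicalPhysics.QuantumLattice.pairField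
                    Literature.MathematicalPhysics.QuantumLattice.dWaveFormFactor L)ᴴ)).re /
              (L : ℝ) ^ 2 ∧
          (Matrix.gibbsState β
                (Literature.MathematicalPhysics.QuantumLattice.dWaveSourceTorus L U μ t)
                (Literature.MathematicalPhysics.QuantumLattice.pairField
                  Literature.MathematicalPhysics.QuantumLattice.dWaveFormFactor L +
                  (Literature.MathematicalPhysics.QuantumLattice.pairField
                    Literature.MathematicalPhysics.QuantumLattice.dWaveFormFactor L)ᴴ)).re /
              (L : ℝ) ^ 2 ≤
            C * (1 + Real.log β) * t := by
  refine ⟨tw_sourcedPairAmplitude_of_inertness, fun hA => ?_⟩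
  refine twSourcedInertness_of_sourcedPairAmplitude fun μ₁ μ₂ h1 h12 h2 => ?_
  obtain ⟨U₀, a, C, hU₀, ha, hC, hU⟩ := hA μ₁ μ₂ h1 h12 h2
  refine ⟨U₀, a, C, hU₀, ha, hC, fun U hU0 hUU₀ β hβ1 hβa μ hμ => ?_⟩
  obtain ⟨L₀, hL₀⟩ := hU U hU0 hUU₀ β hβ1 hβa μ hμ
  exact ⟨L₀, fun L _ hL t ht => (hL₀ L hL t ht).2⟩

end Summit.HubbardSuperconductivity.HubbardSuperconductivity.Theorems
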